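import Summits.BirchSwinnertonDyer.BirchSwinnertonDyer.Theorems.ByReductionTypeAtTwoMultTransportNonPrimitiveCountOfIsogenousTypeB
import Literature.NumberTheory.GaloisRepresentations.LocalKroneckerWeberInertiaProofs
import HarnessLib

/-!
# T-42 in the kernel, XCIX — «F1 ROAD» brick B5 (e): THE TYPE FLIPS ALONG THE `2`-ISOGENY WITH CONNECTED KERNEL —
# if the rational `2`-torsion point `P₀` of `W` lies in the canonical line at `2` (type A, `v₂(x(P₀)) < 0`) and `φ : W → V` is a
# `ℚ`-isogeny with kernel `{O, P₀}`, then the unique rational point of order `2` of `V` (when unique) is NOT in the canonical line of `V`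
# (type B) — audit-2 D-NOTE B5-CHAIN@2 §2 (α), KERNEL, multiplicative AND good ordinary `2`

Cell `bsd-2adic` (run/shared/lean/pub/bsd-2adic/), seat `bsd-2adic-t42` GEN 34 (pen RC-540 SUMMON, brick B5 of road (S-C′), memo
`t42/DESIGN-T42-ADDENDUM-38.md`). HONEST FRAMING: research route; THEOREMS ONLY (no `def`, no named fact, no instance, no `sorry`); nothing
booked; no door or class file is touched (k6); BSD is not proved by any of this. PARTITION: X5@2 multiplicative GV-transport rows (K4ᵐ B1·O1;
items 19922 / 19923) × p = 2 — reduces-the-named-input-of (XCII's side condition `hB`); bears_on K4 (`--supports stmt-BirchSwinnertonDyer-19923`).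

## What

* §1 `exists_tateLine_card_dict_htriv_two` — the Tate line at `v ∋ 2` (same twisted Tate parametrisation as LXXXVI) with (c) `#(C ∩ E[2]) = 2`,
  (iv) the inertial action, (v) Greenberg's §5 dictionary, (d) `2`-divisibility AND (vi) «inertia acts trivially on `E[2^∞]/C`»
  (`GreenbergVatsalTateDatum.tateDatum_htriv`) — (vi) is what LXXXVI's package does not export.
* §2 `exists_mem_absInertia_units_map_eq_pow_three` — an inertia element of `ℚ_2` acting on `μ₄` by `ζ ↦ ζ³` (`χ(σ) = −1`).
* §3 ★ **`not_twoTorsionRamifiedAtTwo_of_twoIsogeny_quotient`** — the flip (D-NOTE §2 (α) in the tree's currency): `Q ∈ W[2] ∖ {O, P₀}` is off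
  `C_W`; `φ(Q)` is a non-zero `Γ_ℚ`-fixed point of `V[2]`, hence the rational point `P_V` (XI); if `P_V ∈ C_V`, halve it (`2S = P_V`), move it by
  an inertia element with `χ ≡ 3 (4)` (`σS − S = P_V`), pull back `S = φ(T)`: `φ(σT − T − Q) = 0` forces `Q ∈ C_W` by (vi) — contradiction.
* §4 `isogenyCert_of_twoIsogeny_quotient` — a type-A `W` whose `2`-isogeny quotient `V` (with `φ`, `ψ`, `ψ ∘ φ = [2]`) has a unique rational
  `2`-torsion abscissa carries the certificate of XCVIII. Honest limit: `V` is an INPUT; uniqueness on `V` fails exactly at the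
  full-`2`-torsion vertices of the descent chain (D-NOTE §3 (β)), whose length is bounded only by Kenku's theorem.

References: [GreenbergVatsal2000] §2 pp. 14–16, p. 28; [GreenbergLNM1716] §2 Prop. 2.4, §5 p. 168 and p. 176; [SilvermanATAEC1994] V.3.1, V.5.2 (c),
V.5.3, Ex. 5.11; [SilvermanAEC2009] III.4.12, III.6.1–6.2, VII.2, VIII.1; [SerreLocalFields1979] IV §4 Prop. 17.
-/

set_option autoImplicit false
set_option linter.dupNamespace false

noncomputable section

open scoped Classical AddSubgroup

namespace Summit.BirchSwinnertonDyer.BirchSwinnertonDyer.Theorems.MultTransportTwistedDescent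

open NumberField IsDedekindDomain Field WeierstrassCurve
  Literature.NumberTheory.GaloisRepresentations Literature.NumberTheory.EllipticCurves
  Literature.NumberTheory.EllipticCurves.GreenbergSelmer IsDedekindDomain.HeightOneSpectrum Rat.HeightOneSpectrum
  Literature.NumberTheory.EllipticCurves.TateCurve Literature.NumberTheory.EllipticCurves.Greenberg1999
  Literature.NumberTheory.EllipticCurves.Rank1Residual
  Summit.BirchSwinnertonDyer.Rank1Residual Summit.BirchSwinnertonDyer.Rank1Residual.X2
  Summit.BirchSwinnertonDyer.Rank1Residual.X2.GreenbergVatsalReductionDatum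
  Summit.BirchSwinnertonDyer.BirchSwinnertonDyer.Theorems.MultTransportAtTwo

/-! ## §1. The Tate line at `2` with card, inertial action, dictionary, divisibility AND the inertia-trivial quotient -/

section TateLine

variable (W : WeierstrassCurve ℚ) [W.IsElliptic] [W.IsGloballyMinimal] {v : HeightOneSpectrum (𝓞 ℚ)}

/-- **The Tate line at `2` with the inertia-trivial quotient**: for the globally minimal `E/ℚ` multiplicative at `2`, `v ∋ 2` and a rational point
`(x, y)` of order `2` — a local datum `N` (the line `ι⁻¹Ψ(μ)` of a twisted Tate parametrisation) with (c) `#(N ∩ E[2]) = 2`, (iv) the inertial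
action through the cyclotomic exponent, (v) `ι(x, y) ∈ N ↔ TwoTorsionRamifiedAtTwo x`, (d) `2`-divisibility, (vi) `τ • m − m ∈ N` for `τ ∈ I_v`
(`tateDatum_htriv`; inertia is `Ψ`-equivariant as it fixes `√γ(E)` at `2`, ATAEC Ex. 5.11). [cite: GreenbergVatsal2000, §2 pp. 14–15]
[cite: GreenbergLNM1716, §2 Prop. 2.4 (pp. 74–75), §5 p. 168 and p. 176] [cite: SilvermanATAEC1994, Thm. V.3.1 (c), Lemma V.5.2 (c), Thm. V.5.3, Ex. 5.11] -/
theorem exists_tateLine_card_dict_htriv_two (hmult : W.HasMultiplicativeReductionAtPrime 2) (hv2 : ((2 : ℕ) : 𝓞 ℚ) ∈ v.asIdeal)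
    {x y : ℚ} (hxy : W.toAffine.Nonsingular x y) (h2 : 2 * y + W.a₁ * x + W.a₃ = 0) :
    ∃ N : LocalDatum ℚ (W.geomPrimaryTorsion 2) v,
      Nat.card ↥(N.plus ⊓ (↥(W.geomPrimaryTorsion 2))[(2 : ℤ)]) = 2 ∧
      (∀ σ ∈ absInertia (v.adicCompletion ℚ), ∀ (n a : ℕ),
        (∀ ζ : (AlgebraicClosure (v.adicCompletion ℚ))ˣ, ζ ^ 2 ^ n = 1 →
          Units.map (Field.absoluteGaloisGroup.toAlgEquiv (v.adicCompletion ℚ) σ :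
            AlgebraicClosure (v.adicCompletion ℚ) →* AlgebraicClosure (v.adicCompletion ℚ)) ζ = ζ ^ a) →
        ∀ c ∈ N.plus, 2 ^ n • c = 0 →
          resGal (K := ℚ) (v.adicCompletion ℚ) σ • c = a • c) ∧
      (∀ m : W.geomPrimaryTorsion 2, (m : W.geomPoints) = toGeomPoints W (.some x y hxy) →
        (m ∈ N.plus ↔ TwoTorsionRamifiedAtTwo x)) ∧
      (∀ c ∈ N.plus, ∃ c' ∈ N.plus, 2 • c' = c) ∧
      (∀ τ ∈ inertia v, ∀ m : W.geomPrimaryTorsion 2, τ • m - m ∈ N.plus) := by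
  have hv : W.HasMultiplicativeReductionAt v :=
    GreenbergVatsalStrictSelmerMultiplicative.hasMultiplicativeReductionAt_of_mem W 2 hmult hv2
  obtain ⟨q, t, Ψ, hq0, hq1, -, -, -, ht2, hsurj, hker, hΨσ⟩ := exists_twistedTateUniformisation_tateJ W v hv
  have hΦ : ∀ (σ : absoluteGaloisGroup (v.adicCompletion ℚ))
      (u : (AlgebraicClosure (v.adicCompletion ℚ))ˣ),
      σ • Ψ (Additive.ofMul u) = Ψ (Additive.ofMul (Units.map
        (Field.absoluteGaloisGroup.toAlgEquiv (v.adicCompletion ℚ) σ :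
          AlgebraicClosure (v.adicCompletion ℚ) →* AlgebraicClosure (v.adicCompletion ℚ)) u)) ∨
      σ • Ψ (Additive.ofMul u) = -Ψ (Additive.ofMul (Units.map
        (Field.absoluteGaloisGroup.toAlgEquiv (v.adicCompletion ℚ) σ :
          AlgebraicClosure (v.adicCompletion ℚ) →* AlgebraicClosure (v.adicCompletion ℚ)) u)) := by
    intro σ u
    rw [hΨσ σ u]
    split_ifs
    · exact Or.inl (one_zsmul _)
    · exact Or.inr (by rw [neg_one_zsmul])
  have hker' : ∀ u : (AlgebraicClosure (v.adicCompletion ℚ))ˣ, Ψ (Additive.ofMul u) = 0 →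
      ∃ a : ℤ, (u : AlgebraicClosure (v.adicCompletion ℚ)) =
        algebraMap (v.adicCompletion ℚ) (AlgebraicClosure (v.adicCompletion ℚ)) q ^ a := fun u h ↦ (hker u).1 h
  -- inertia is `Ψ`-equivariant (it fixes `t`)
  have hΦI : ∀ σ ∈ absInertia (v.adicCompletion ℚ), ∀ u : (AlgebraicClosure (v.adicCompletion ℚ))ˣ,
      σ • Ψ (Additive.ofMul u) = Ψ (Additive.ofMul (Units.map
        (Field.absoluteGaloisGroup.toAlgEquiv (v.adicCompletion ℚ) σ :
          AlgebraicClosure (v.adicCompletion ℚ) →* AlgebraicClosure (v.adicCompletion ℚ)) u)) := by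
    intro σ hσ u
    rw [hΨσ σ u, if_pos (TateTwistUnramifiedAtTwo.inertia_fix_sqrt_gamma_two W hmult hv2 t ht2 σ hσ), one_zsmul]
  refine ⟨GreenbergVatsalTateDatum.tateDatum W 2 Ψ hΦ,
    GreenbergVatsalTateDatumCofree.natCard_tateDatum_plus_inf_torsionBy W 2 Ψ hΦ hq0 hq1 hker', ?_, ?_,
    GreenbergVatsalTateDatumCofree.tateDatum_plus_divisible W 2 Ψ hΦ,
    GreenbergVatsalTateDatum.tateDatum_htriv W 2 Ψ hΦ hsurj hker' hΦI⟩
  · intro σ hσ n a hroots c hc hcn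
    haveI : CharZero (v.adicCompletion ℚ) := charZero_adicCompletion v
    obtain ⟨ζ, hζfin, hζc⟩ := (GreenbergVatsalTateDatum.mem_tateDatum_plus_iff hΦ c).1 hc
    have hζn : ζ ^ 2 ^ n = 1 := by
      have h0 : Ψ (Additive.ofMul (ζ ^ 2 ^ n)) = 0 := by
        rw [ofMul_pow, map_nsmul, hζc, ← map_nsmul, ← AddSubmonoidClass.coe_nsmul, hcn, ZeroMemClass.coe_zero,
          map_zero]
      exact X2.GreenbergVatsalTateKummerLocal.eq_one_of_isOfFinOrder_of_map_eq_zero W Ψ hker' hq0 hq1 (hζfin.pow) h0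
    apply GreenbergVatsalTateDatumCofree.pointsMap_coe_injective W 2 (v := v)
    dsimp only
    rw [primaryComponent.coe_smul, pointsMap_smul, AddSubmonoidClass.coe_nsmul, map_nsmul, ← hζc, hΦI σ hσ ζ,
      hroots ζ hζn, ofMul_pow, map_nsmul]
  · intro m hm
    rw [GreenbergVatsalTateDatum.mem_tateDatum_plus_iff hΦ m, hm]
    exact twoTorsion_mem_tateLine_iff_ramifiedAtTwo_holds W hmult v hv2 q t Ψ hq0 hq1 ht2 hsurj hker hΨσ x y hxy h2

end TateLine

/-! ## §2. An inertia element at `2` acting on `μ₄` by inversion -/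
/-- **An element of the inertia group of `ℚ_2` acting on `μ₄` as `ζ ↦ ζ³`**: the local cyclotomic character maps the inertia group onto
`ℤ₂ˣ` (`adicCompletion_rat_exists_mem_absInertia_cyclotomicCharacter_eq`, Serre *Local Fields* IV §4 Prop. 17); take `χ(σ) = −1`, which is `3`
modulo `4`. [cite: SerreLocalFields1979, Ch. IV §4 Prop. 17] -/
theorem exists_mem_absInertia_units_map_eq_pow_three {v : HeightOneSpectrum (𝓞 ℚ)} (hv2 : ((2 : ℕ) : 𝓞 ℚ) ∈ v.asIdeal) :
    ∃ σ ∈ absInertia (v.adicCompletion ℚ),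
      ∀ ζ : (AlgebraicClosure (v.adicCompletion ℚ))ˣ, ζ ^ 2 ^ 2 = 1 →
        Units.map (Field.absoluteGaloisGroup.toAlgEquiv (v.adicCompletion ℚ) σ :
          AlgebraicClosure (v.adicCompletion ℚ) →* AlgebraicClosure (v.adicCompletion ℚ)) ζ = ζ ^ 3 := by
  haveI : Fact (Nat.Prime 2) := ⟨Nat.prime_two⟩
  -- `primesEquiv v = 2`
  have hv' : (primesEquiv v : ℕ) = 2 := by
    have h1 : natGenerator v ∣ 2 := by
      rw [natGenerator_dvd_iff, Ideal.mem_map_of_equiv]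
      exact ⟨2, hv2, map_natCast _ 2⟩
    exact (Nat.prime_dvd_prime_iff_eq (prime_natGenerator v) Nat.prime_two).mp h1
  obtain ⟨σ, hσI, hχ⟩ := adicCompletion_rat_exists_mem_absInertia_cyclotomicCharacter_eq 2 v hv' (-1)
  refine ⟨σ, hσI, fun ζ hζ ↦ ?_⟩
  haveI : CharZero (v.adicCompletion ℚ) := charZero_adicCompletion v
  haveI : NeZero ((2 : ℕ) : v.adicCompletion ℚ) := ⟨Nat.cast_ne_zero.mpr two_ne_zero⟩
  have hζ' : (ζ : AlgebraicClosure (v.adicCompletion ℚ)) ^ 2 ^ 2 = 1 := by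
    rw [← Units.val_pow_eq_pow_val, hζ, Units.val_one]
  have hspec := GaloisRep.cyclotomicCharacter_spec (v.adicCompletion ℚ) 2 (k := 2) σ (ζ : AlgebraicClosure (v.adicCompletion ℚ)) hζ'
  rw [hχ] at hspec
  have h3 : (((-1 : ℤ_[2]ˣ) : ℤ_[2]).toZModPow 2).val = 3 := by
    rw [Units.val_neg, Units.val_one, map_neg, map_one]
    rfl
  rw [h3] at hspec
  ext
  rw [Units.coe_map, MonoidHom.coe_coe, Units.val_pow_eq_pow_val, ← hspec, Field.absoluteGaloisGroup.smul_def]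

/-! ## §3. ★ The type flips along the `2`-isogeny with connected kernel -/
section Flip

variable (W : WeierstrassCurve ℚ) [W.IsElliptic] [W.IsGloballyMinimal]
  (V : WeierstrassCurve ℚ) [V.IsElliptic] [V.IsGloballyMinimal]

/-- **The line data needed on both sides, uniformly in the reduction type** (multiplicative: §1 and LXXXVI; good ordinary: Greenberg's reduction
datum, LXXXVI §3 + `reductionDatum_htriv`): for `W` (resp. an isogenous `V`) with multiplicative or good ordinary reduction at `2` and a rational
point `(x, y)` of order `2`, a local datum at `v ∋ 2` with (c), (v), (vi) for `W` — and with (d), (iv), (v) for `V`. Packaged once here as two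
existence statements. [cite: GreenbergLNM1716, §2 Props. 2.2, 2.4, §5 p. 168 and p. 176] [cite: GreenbergVatsal2000, §2 pp. 14–16, 26] -/
theorem exists_line_card_dict_htriv_two (κ : ZpExtension ℚ 2) (hκ : κ.IsCyclotomic)
    (hred : W.HasMultiplicativeReductionAtPrime 2 ∨ IsOrdinaryAt W 2) {v : HeightOneSpectrum (𝓞 ℚ)} (hv2 : ((2 : ℕ) : 𝓞 ℚ) ∈ v.asIdeal)
    {x y : ℚ} (hxy : W.toAffine.Nonsingular x y) (h2 : 2 * y + W.a₁ * x + W.a₃ = 0) :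
    ∃ N : LocalDatum ℚ (W.geomPrimaryTorsion 2) v,
      Nat.card ↥(N.plus ⊓ (↥(W.geomPrimaryTorsion 2))[(2 : ℤ)]) = 2 ∧
      (∀ m : W.geomPrimaryTorsion 2, (m : W.geomPoints) = toGeomPoints W (.some x y hxy) →
        (m ∈ N.plus ↔ TwoTorsionRamifiedAtTwo x)) ∧
      (∀ τ ∈ inertia v, ∀ m : W.geomPrimaryTorsion 2, τ • m - m ∈ N.plus) := by
  haveI : Fact (Nat.Prime 2) := ⟨Nat.prime_two⟩
  rcases hred with hmult | hord
  · obtain ⟨N, hcard, -, hdict, -, htriv⟩ := exists_tateLine_card_dict_htriv_two W hmult hv2 hxy h2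
    exact ⟨N, hcard, hdict, htriv⟩
  · obtain ⟨hgood, hord2⟩ := id hord
    have hΔ2 : ¬ ((2 : ℕ) : ℤ) ∣ W.minimalDiscriminantInt := W.not_dvd_minimalDiscriminantInt_of_hasGoodReductionAtPrime' 2 hgood
    have hord' : ¬ (2 : ℤ) ∣ W.frobeniusTrace 2 := by exact_mod_cast hord2
    obtain ⟨-, hcard, -, -, hdict⟩ := reductionDatum_package_dict_two W κ hκ hv2 hgood hord' hΔ2 hxy h2
    exact ⟨reductionDatum W 2 hv2 hΔ2, hcard, hdict, reductionDatum_htriv W 2 hv2 hΔ2⟩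

omit [W.IsElliptic] [W.IsGloballyMinimal] in
/-- The target-side data: (d) divisibility, (iv) inertial action, (v) dictionary (LXXXVI's packages, both reduction types).
[cite: GreenbergLNM1716, §2 Props. 2.2, 2.4, §5 p. 168 and p. 176] [cite: GreenbergVatsal2000, §2 pp. 14–16] -/
theorem exists_line_div_inert_dict_two (κ : ZpExtension ℚ 2) (hκ : κ.IsCyclotomic)
    (hred : V.HasMultiplicativeReductionAtPrime 2 ∨ IsOrdinaryAt V 2) {v : HeightOneSpectrum (𝓞 ℚ)} (hv2 : ((2 : ℕ) : 𝓞 ℚ) ∈ v.asIdeal)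
    {x y : ℚ} (hxy : V.toAffine.Nonsingular x y) (h2 : 2 * y + V.a₁ * x + V.a₃ = 0) :
    ∃ N : LocalDatum ℚ (V.geomPrimaryTorsion 2) v,
      (∀ c ∈ N.plus, ∃ c' ∈ N.plus, 2 • c' = c) ∧
      (∀ σ ∈ absInertia (v.adicCompletion ℚ), ∀ (n a : ℕ),
        (∀ ζ : (AlgebraicClosure (v.adicCompletion ℚ))ˣ, ζ ^ 2 ^ n = 1 →
          Units.map (Field.absoluteGaloisGroup.toAlgEquiv (v.adicCompletion ℚ) σ :
            AlgebraicClosure (v.adicCompletion ℚ) →* AlgebraicClosure (v.adicCompletion ℚ)) ζ = ζ ^ a) →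
        ∀ c ∈ N.plus, 2 ^ n • c = 0 →
          resGal (K := ℚ) (v.adicCompletion ℚ) σ • c = a • c) ∧
      (∀ m : V.geomPrimaryTorsion 2, (m : V.geomPoints) = toGeomPoints V (.some x y hxy) →
        (m ∈ N.plus ↔ TwoTorsionRamifiedAtTwo x)) := by
  haveI : Fact (Nat.Prime 2) := ⟨Nat.prime_two⟩
  rcases hred with hmult | hord
  · obtain ⟨N, hdiv, -, -, hInert, hdict⟩ := exists_tateLine_package_dict_two V κ hκ hmult hv2 hxy h2
    exact ⟨N, hdiv, hInert, hdict⟩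
  · obtain ⟨hgood, hord2⟩ := id hord
    have hΔ2 : ¬ ((2 : ℕ) : ℤ) ∣ V.minimalDiscriminantInt := V.not_dvd_minimalDiscriminantInt_of_hasGoodReductionAtPrime' 2 hgood
    have hord' : ¬ (2 : ℤ) ∣ V.frobeniusTrace 2 := by exact_mod_cast hord2
    obtain ⟨hdiv, -, -, hInert, hdict⟩ := reductionDatum_package_dict_two V κ hκ hv2 hgood hord' hΔ2 hxy h2
    exact ⟨reductionDatum V 2 hv2 hΔ2, hdiv, hInert, hdict⟩

/-- ★ **THE TYPE FLIPS ALONG THE `2`-ISOGENY WITH CONNECTED KERNEL** (audit-2 D-NOTE B5-CHAIN@2 §2 (α), kernel, multiplicative AND good ordinary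
`2`). Let `W/ℚ` be globally minimal, multiplicative or good ordinary at `2`, with a rational point `P₀ = (x, y)` of order `2` of TYPE A
(`TwoTorsionRamifiedAtTwo x`: `P₀` lies in the canonical line `C₂`); let `V/ℚ` be globally minimal and `φ : W → V` a `ℚ`-isogeny killing `P₀`
whose kernel is contained in `{O, P₀}` (the quotient `W → W/⟨P₀⟩`). If `V` has EXACTLY ONE rational point of order `2`, of abscissa `x_V`, then
`¬ TwoTorsionRamifiedAtTwo x_V` — that point is of TYPE B. (On the Tate curve: `P₀ = −1 ∈ μ` on `ℚ₂ˣ/q^ℤ`, and the rational `2`-torsion point of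
`ℚ₂ˣ/q^{2ℤ}` is `q ∉ μ`.) [cite: GreenbergVatsal2000, §2 pp. 14–16 and p. 28] [cite: GreenbergLNM1716, §5 p. 168 and p. 176]
[cite: SilvermanATAEC1994, Thm. V.3.1, Lemma V.5.2 (c), Thm. V.5.3] [cite: SilvermanAEC2009, Thm. III.6.2, VII.2, VIII.1] -/
theorem not_twoTorsionRamifiedAtTwo_of_twoIsogeny_quotient (κ : ZpExtension ℚ 2) (hκ : κ.IsCyclotomic)
    (hred : W.HasMultiplicativeReductionAtPrime 2 ∨ IsOrdinaryAt W 2)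
    {x y : ℚ} (hxy : W.toAffine.Nonsingular x y) (h2 : 2 * y + W.a₁ * x + W.a₃ = 0) (hA : TwoTorsionRamifiedAtTwo x)
    (φ : Isogeny W V) (hφ0 : φ (toGeomPoints W (.some x y hxy)) = 0)
    (hφker : ∀ P : W.geomPoints, φ P = 0 → P = 0 ∨ P = toGeomPoints W (.some x y hxy))
    {xV : ℚ} (hxV : HasUniqueRationalTwoTorsionX V xV) :
    ¬ TwoTorsionRamifiedAtTwo xV := by
  haveI : Fact (Nat.Prime 2) := ⟨Nat.prime_two⟩
  intro hAV
  -- the place above `2`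
  obtain ⟨v, hv2⟩ : ∃ v : HeightOneSpectrum (𝓞 ℚ), ((2 : ℕ) : 𝓞 ℚ) ∈ v.asIdeal := by
    refine ⟨primesEquiv.symm ⟨2, Nat.prime_two⟩, ?_⟩
    have h := natCast_natGenerator_mem (primesEquiv.symm ⟨2, Nat.prime_two⟩)
    have hgen : natGenerator (primesEquiv (R := 𝓞 ℚ).symm ⟨2, Nat.prime_two⟩) = 2 :=
      congrArg Subtype.val (primesEquiv.apply_symm_apply (⟨2, Nat.prime_two⟩ : Nat.Primes))
    rw [hgen] at h
    exact h
  -- `V` is multiplicative / good ordinary at `2` as well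
  have hredV : V.HasMultiplicativeReductionAtPrime 2 ∨ IsOrdinaryAt V 2 := mult_or_ord_of_isIsogenous W V ⟨φ⟩ hred
  -- the rational points of order `2`: `P₀` on `W` (given), `P_V = (x_V, y_V)` on `V`
  obtain ⟨yV, hxyVEq, h2V⟩ := hxV.1
  have hxyV : V.toAffine.Nonsingular xV yV := (WeierstrassCurve.Affine.equation_iff_nonsingular).mp hxyVEq
  -- the two line packages
  obtain ⟨NW, hcardW, hdictW, htrivW⟩ := exists_line_card_dict_htriv_two W κ hκ hred hv2 hxy h2
  obtain ⟨NV, hdivV, hInertV, hdictV⟩ := exists_line_div_inert_dict_two V κ hκ hredV hv2 hxyV h2V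
  -- ### `W`-side: `P₀ ∈ C_W`, and `C_W ∩ W[2] = {0, P₀}`
  set P₀ : W.geomPoints := toGeomPoints W (.some x y hxy) with hP₀def
  have hP₀2 : P₀ + P₀ = 0 := by
    obtain ⟨y₁, h₁, P₁, hP₁, -, -, h2₁⟩ := exists_geomTorsion_two_of_hasRationalTwoTorsionX W ⟨y,
      (WeierstrassCurve.Affine.equation_iff_nonsingular).mpr hxy, h2⟩
    obtain rfl : y₁ = y := by linarith
    have hP₁g : (P₁ : W.geomPoints) = P₀ := by
      rw [hP₁, hP₀def]
      exact (some_eq_some_geomPoints W (X₁ := algebraMap ℚ (AlgebraicClosure ℚ) x) (Y₁ := algebraMap ℚ (AlgebraicClosure ℚ) y₁)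
        (h₁ := (WeierstrassCurve.Affine.baseChange_nonsingular (W := W.toAffine) (Algebra.ofId ℚ (AlgebraicClosure ℚ)).injective ..).mpr hxy)
        (eq_ratCast _ x) (eq_ratCast _ y₁)).symm
    rw [← hP₁g, ← AddSubgroup.coe_add, add_self_geomTorsion_two W P₁, ZeroMemClass.coe_zero]
  have hP₀ne : P₀ ≠ 0 := by
    rw [hP₀def]
    intro h
    exact WeierstrassCurve.Affine.Point.some_ne_zero hxy (toGeomPoints_injective W (by rw [h, map_zero]))
  have hmem2 : ∀ {P : W.geomPoints}, P + P = 0 → P ∈ W.geomPrimaryTorsion 2 := fun {P} hP ↦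
    (AddCommGroup.mem_primaryComponent).mpr ⟨1, by rw [pow_one, two_nsmul]; exact hP⟩
  have hP₀C : (⟨P₀, hmem2 hP₀2⟩ : W.geomPrimaryTorsion 2) ∈ NW.plus := (hdictW ⟨P₀, hmem2 hP₀2⟩ rfl).2 hA
  -- every `2`-torsion element of `C_W` is `0` or `P₀`
  have hCW2 : ∀ m : W.geomPrimaryTorsion 2, m ∈ NW.plus → (m : W.geomPoints) + m = 0 → (m : W.geomPoints) = 0 ∨ (m : W.geomPoints) = P₀ := by
    intro m hm hm2
    by_contra hnot
    push Not at hnot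
    have htor : ∀ {P : W.geomPoints} (hP : P + P = 0), (⟨P, hmem2 hP⟩ : W.geomPrimaryTorsion 2) ∈ (↥(W.geomPrimaryTorsion 2))[(2 : ℤ)] :=
      fun {P} hP ↦ (Submodule.mem_torsionBy_iff (2 : ℤ) _).mpr
        (by rw [two_zsmul]; exact Subtype.ext (by rw [AddSubgroup.coe_add, ZeroMemClass.coe_zero]; exact hP))
    let e0 : ↥(NW.plus ⊓ (↥(W.geomPrimaryTorsion 2))[(2 : ℤ)]) := ⟨0, (NW.plus ⊓ _).zero_mem⟩
    let eP : ↥(NW.plus ⊓ (↥(W.geomPrimaryTorsion 2))[(2 : ℤ)]) := ⟨⟨P₀, hmem2 hP₀2⟩, hP₀C, htor hP₀2⟩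
    have hm' : m = ⟨(m : W.geomPoints), hmem2 hm2⟩ := Subtype.ext rfl
    let em : ↥(NW.plus ⊓ (↥(W.geomPrimaryTorsion 2))[(2 : ℤ)]) := ⟨⟨(m : W.geomPoints), hmem2 hm2⟩, hm' ▸ hm, htor hm2⟩
    obtain ⟨u, -, huniq⟩ := (Nat.card_eq_two_iff' e0).mp hcardW
    have hP : eP = u := huniq eP (fun h ↦ hP₀ne (by simpa [eP, e0] using congrArg (fun z ↦ ((z.1 : W.geomPrimaryTorsion 2) : W.geomPoints)) h))
    have hM : em = u := huniq em (fun h ↦ hnot.1 (by simpa [em, e0] using congrArg (fun z ↦ ((z.1 : W.geomPrimaryTorsion 2) : W.geomPoints)) h))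
    exact hnot.2 (by simpa [em, eP] using congrArg (fun z ↦ ((z.1 : W.geomPrimaryTorsion 2) : W.geomPoints)) (hM.trans hP.symm))
  -- ### a point `Q ∈ W[2]` off `{0, P₀}`, hence off `C_W`
  obtain ⟨Q, hQ2, hQ0, hQP⟩ : ∃ Q : W.geomPoints, Q + Q = 0 ∧ Q ≠ 0 ∧ Q ≠ P₀ := by
    by_contra hnone
    push Not at hnone
    have hsurj : Function.Surjective (fun b : Bool ↦ if b then (⟨P₀, by
        rw [WeierstrassCurve.mem_geomTorsion_iff, two_zsmul]; exact hP₀2⟩ : W.geomTorsion 2) else 0) := by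
      intro T
      have hT2 : (T : W.geomPoints) + T = 0 := by
        rw [← AddSubgroup.coe_add, add_self_geomTorsion_two W T, ZeroMemClass.coe_zero]
      by_cases hT0 : (T : W.geomPoints) = 0
      · exact ⟨false, Subtype.ext (by simpa using hT0.symm)⟩
      · exact ⟨true, Subtype.ext (by simpa using (hnone T hT2 hT0).symm)⟩
    have hle := Nat.card_le_card_of_surjective _ hsurj
    rw [MultTransportAtTwo.natCard_geomTorsion_two W, Nat.card_eq_fintype_card, Fintype.card_bool] at hle
    omega
  have hQC : (⟨Q, hmem2 hQ2⟩ : W.geomPrimaryTorsion 2) ∉ NW.plus := fun h ↦ by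
    rcases hCW2 _ h hQ2 with h0 | hP
    · exact hQ0 h0
    · exact hQP hP
  -- ### `φ Q` is a non-zero `Γ_ℚ`-fixed point of `V[2]`, hence the rational point `(x_V, y_V)`
  have hφQ2 : φ Q + φ Q = 0 := by rw [← map_add, hQ2, map_zero]
  have hφQ0 : φ Q ≠ 0 := fun h ↦ by
    rcases hφker Q h with h0 | hP
    · exact hQ0 h0
    · exact hQP hP
  have hφQfix : ∀ τ : absoluteGaloisGroup ℚ, τ • φ Q = φ Q := by
    intro τ
    -- `τ • Q ∈ {Q, Q + P₀}`
    let Qt : W.geomTorsion 2 := ⟨Q, by rw [WeierstrassCurve.mem_geomTorsion_iff, two_zsmul]; exact hQ2⟩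
    let Pt : W.geomTorsion 2 := ⟨P₀, by rw [WeierstrassCurve.mem_geomTorsion_iff, two_zsmul]; exact hP₀2⟩
    have hPt0 : Pt ≠ 0 := fun h ↦ hP₀ne (congrArg Subtype.val h)
    have hPtfix : ∀ σ : absoluteGaloisGroup ℚ, σ • Pt = Pt := fun σ ↦
      Subtype.ext (by rw [AddSubgroup.torsionBy.coe_smul]; exact smul_toGeomPoints W σ _)
    rw [← φ.map_smul]
    rcases smul_eq_self_or_eq_add W hPt0 hPtfix τ Qt with h | h
    · exact congrArg φ (congrArg Subtype.val h :)
    · have h' : τ • Q = Q + P₀ := congrArg Subtype.val h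
      rw [h', map_add, hφ0, add_zero]
  obtain ⟨yV₁, hV₁, PV, hPV, hPV0, -, h2V₁⟩ := exists_geomTorsion_two_of_hasRationalTwoTorsionX V hxV.1
  have hyV : yV₁ = yV := by linarith
  have hPVg : (PV : V.geomPoints) = toGeomPoints V (.some xV yV hxyV) := by
    rw [hPV]
    exact (some_eq_some_geomPoints V (X₁ := algebraMap ℚ (AlgebraicClosure ℚ) xV) (Y₁ := algebraMap ℚ (AlgebraicClosure ℚ) yV)
      (h₁ := (WeierstrassCurve.Affine.baseChange_nonsingular (W := V.toAffine) (Algebra.ofId ℚ (AlgebraicClosure ℚ)).injective ..).mpr hxyV)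
      (eq_ratCast _ xV) (by rw [eq_ratCast, hyV])).symm
  have hφQ_eq : φ Q = toGeomPoints V (.some xV yV hxyV) := by
    let Tt : V.geomTorsion 2 := ⟨φ Q, by rw [WeierstrassCurve.mem_geomTorsion_iff, two_zsmul]; exact hφQ2⟩
    have hTfix : ∀ σ : absoluteGaloisGroup ℚ, σ • Tt = Tt := fun σ ↦
      Subtype.ext (by rw [AddSubgroup.torsionBy.coe_smul]; exact hφQfix σ)
    rcases eq_zero_or_eq_of_smul_eq V hxV hV₁ h2V₁ hPV hTfix with h0 | hT
    · exact absurd (congrArg Subtype.val h0) hφQ0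
    · rw [← hPVg]; exact congrArg Subtype.val hT
  -- ### `V`-side: `φ Q ∈ C_V` (type A on `V`, to be refuted); halve it and move it by inertia
  have hmem2V : ∀ {P : V.geomPoints}, P + P = 0 → P ∈ V.geomPrimaryTorsion 2 := fun {P} hP ↦
    (AddCommGroup.mem_primaryComponent).mpr ⟨1, by rw [pow_one, two_nsmul]; exact hP⟩
  have hφQC : (⟨φ Q, hmem2V hφQ2⟩ : V.geomPrimaryTorsion 2) ∈ NV.plus := (hdictV ⟨φ Q, hmem2V hφQ2⟩ hφQ_eq).2 hAV
  obtain ⟨S, hSC, h2S⟩ := hdivV _ hφQC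
  have h4S : 2 ^ 2 • S = 0 := by
    rw [show (2 : ℕ) ^ 2 = 2 * 2 from rfl, mul_smul, h2S]
    exact Subtype.ext (by rw [AddSubmonoidClass.coe_nsmul, ZeroMemClass.coe_zero, two_nsmul]; exact hφQ2)
  obtain ⟨σ, hσI, hσ4⟩ := exists_mem_absInertia_units_map_eq_pow_three hv2
  have hσS : resGal (K := ℚ) (v.adicCompletion ℚ) σ • S = 3 • S := hInertV σ hσI 2 3 hσ4 S hSC h4S
  have hσS' : resGal (K := ℚ) (v.adicCompletion ℚ) σ • S - S = ⟨φ Q, hmem2V hφQ2⟩ := by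
    rw [hσS, ← h2S, show (3 : ℕ) = 2 + 1 from rfl, add_nsmul, one_nsmul, add_sub_cancel_right]
  -- ### pull `S` back along `φ` and conclude on `W`
  obtain ⟨T₀, hT₀⟩ := φ.surjective (S : V.geomPoints)
  have hT₀8 : 2 ^ 3 • T₀ = 0 := by
    have h4 : φ (2 ^ 2 • T₀) = 0 := by
      rw [map_nsmul, hT₀, ← AddSubmonoidClass.coe_nsmul, h4S, ZeroMemClass.coe_zero]
    rcases hφker _ h4 with h0 | hP
    · rw [show (2 : ℕ) ^ 3 = 2 * 2 ^ 2 from rfl, mul_smul, h0, smul_zero]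
    · rw [show (2 : ℕ) ^ 3 = 2 * 2 ^ 2 from rfl, mul_smul, hP, two_nsmul, hP₀2]
  let T : W.geomPrimaryTorsion 2 := ⟨T₀, (AddCommGroup.mem_primaryComponent).mpr ⟨3, hT₀8⟩⟩
  have hfT : primaryTorsionMap 2 φ.toAddMonoidHom T = S := Subtype.ext (by rw [coe_primaryTorsionMap_apply]; exact hT₀)
  set τ : absoluteGaloisGroup ℚ := resGal (K := ℚ) (v.adicCompletion ℚ) σ with hτdef
  have hτI : τ ∈ inertia v := by
    rw [hτdef, resGal_eq_absGaloisRestrict]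
    exact Subgroup.mem_map.2 ⟨σ, hσI, rfl⟩
  -- `φ (τT − T − Q) = 0`
  have hdiffC : τ • T - T ∈ NW.plus := htrivW τ hτI T
  have hφdiff : φ ((τ • T - T : W.geomPrimaryTorsion 2) : W.geomPoints) = φ Q := by
    have h := congrArg (fun m : V.geomPrimaryTorsion 2 ↦ (m : V.geomPoints)) hσS'
    dsimp only at h
    rw [← hfT, ← primaryTorsionMap_smul 2 φ.toAddMonoidHom φ.equivariant, ← map_sub, coe_primaryTorsionMap_apply] at h
    exact h
  have hkerQ : ((τ • T - T : W.geomPrimaryTorsion 2) : W.geomPoints) - Q = 0 ∨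
      ((τ • T - T : W.geomPrimaryTorsion 2) : W.geomPoints) - Q = P₀ :=
    hφker _ (by rw [map_sub, hφdiff, sub_self])
  -- in both cases `Q ∈ C_W`
  apply hQC
  rcases hkerQ with h0 | hP
  · have hQeq : (⟨Q, hmem2 hQ2⟩ : W.geomPrimaryTorsion 2) = τ • T - T := Subtype.ext (sub_eq_zero.mp h0).symm
    rw [hQeq]; exact hdiffC
  · have hQeq : (⟨Q, hmem2 hQ2⟩ : W.geomPrimaryTorsion 2) = (τ • T - T) - ⟨P₀, hmem2 hP₀2⟩ :=
      Subtype.ext (by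
        rw [AddSubgroupClass.coe_sub]
        exact eq_sub_of_add_eq (by rw [eq_add_of_sub_eq hP, add_comm]))
    rw [hQeq]; exact NW.plus.sub_mem hdiffC hP₀C

/-! ## §4. The certificate of XCVIII for a type-A curve with a «good» 2-isogeny quotient -/

/-- **A type-A curve whose `2`-isogeny quotient has a unique rational point of order `2` is certified** (the `∃` consumed by XCVIII
`multCongruenceTransportAtTwo_of_printFacts_noF1_ofIsogenyCert`): given `W` (multiplicative or good ordinary at `2`, rational `P₀ = (x, y)` of
order `2` of type A), a globally minimal `V`, `ℚ`-isogenies `φ : W → V`, `ψ : V → W` with `ψ ∘ φ = [2]`, `φ(P₀) = O`, `ker φ ⊆ {O, P₀}`, and a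
UNIQUE rational `2`-torsion abscissa `x_V` on `V`: the certificate holds with `e = 1` (§3 supplies the type-B clause).
[cite: GreenbergVatsal2000, §2 p. 28] [cite: GreenbergLNM1716, §5 p. 176] [cite: SilvermanAEC2009, III.4.12, III.6.1–6.2] -/
theorem isogenyCert_of_twoIsogeny_quotient (κ : ZpExtension ℚ 2) (hκ : κ.IsCyclotomic)
    (hred : W.HasMultiplicativeReductionAtPrime 2 ∨ IsOrdinaryAt W 2)
    {x y : ℚ} (hxy : W.toAffine.Nonsingular x y) (h2 : 2 * y + W.a₁ * x + W.a₃ = 0) (hA : TwoTorsionRamifiedAtTwo x)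
    (φ : Isogeny W V) (ψ : Isogeny V W) (hψφ : ∀ P : W.geomPoints, ψ (φ P) = ((2 ^ 1 : ℕ) : ℤ) • P)
    (hφ0 : φ (toGeomPoints W (.some x y hxy)) = 0)
    (hφker : ∀ P : W.geomPoints, φ P = 0 → P = 0 ∨ P = toGeomPoints W (.some x y hxy))
    {xV : ℚ} (hxV : HasUniqueRationalTwoTorsionX V xV) :
    ∃ (V : WeierstrassCurve ℚ) (_ : V.IsElliptic) (_ : V.IsGloballyMinimal) (φ : Isogeny W V) (ψ : Isogeny V W) (e : ℕ) (xV : ℚ),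
      (∀ P : W.geomPoints, ψ (φ P) = ((2 ^ e : ℕ) : ℤ) • P) ∧ HasUniqueRationalTwoTorsionX V xV ∧ ¬ TwoTorsionRamifiedAtTwo xV :=
  ⟨V, ‹_›, ‹_›, φ, ψ, 1, xV, hψφ, hxV,
    not_twoTorsionRamifiedAtTwo_of_twoIsogeny_quotient W V κ hκ hred hxy h2 hA φ hφ0 hφker hxV⟩

end Flip

end Summit.BirchSwinnertonDyer.BirchSwinnertonDyer.Theorems.MultTransportTwistedDescent

end
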